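import Summits.BirchSwinnertonDyer.BirchSwinnertonDyer.Theorems.SignedLowerHalvesSmallImageLowerHalfBothSignsRttReciprocityUniqueCongr
import Summits.BirchSwinnertonDyer.BirchSwinnertonDyer.Theorems.ResidualThetaTransportAtTwoResidualSignedLambdaLowerCMAtTwoRelayDescends
import HarnessLib

/-!
# Route `SignedLowerHalves`, crux L `SmallImageLowerHalfBothSigns` (stmt-BirchSwinnertonDyer-23599), line `rtt_w3` v30 → v31 — row S4′ (`stub_junctionReciprocity_ns`), brick β7, LEAD g14, part 3:
# FROM LEVELWISE MAZUR–TATE CONGRUENCES OF THE COLEMAN IMAGE TO THE RECIPROCITY IDENTITY `ι(Col x) = C c′ · ι L` (the relay S4″ ⟹ S4′)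

Sequel of `…RttReciprocityUniqueCongr` (★★★ `eq_of_forall_isCongrModOmegaO`). The reciprocity row of the line asks `ι_S(Col (jv (s ζ̄_𝔞))) = C c′ · ι_{range ι} L` for the `L` pinned by the
prefix's `hcongr` (`θ_n(g) ≡ (−1)^{n/2+1} ω_n^∓ L (mod ω_n)`, all `n` of parity `ε`). Print (Kobayashi 2003 Thm. 6.3, Pollack–Rubin 2004 §6, Kim–Park 2017 §3–§5) delivers the
Coleman image LEVELWISE, as Mazur–Tate-type congruences. THIS FILE is the kernel relay between the two shapes, over two coefficient sets `S` (the frame's `𝒪`) and `T` (= `range ι`):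
* `IsCongrModOmegaO.C_mul` — scaling a congruence by an integral constant `d`: `θ ≡ W·ι L ⟹ d·θ ≡ W·ι(d·L)`;
* ★★★ `iwasawaO_eq_C_mul_of_congruences` — if `x ∈ 𝒪_S⟦T⟧` satisfies `d·θ_n ≡ W_n·(c·ι_S x) (mod ω_n)` over `S ∪ T` for all `n` of parity `ε` (`c, d ∈ 𝒪_{S∪T}` non-zero) and
  `L ∈ 𝒪_T⟦T⟧` satisfies `θ_n ≡ W_n·ι_T L`, then `ι_S x = C (d/c) · ι_T L` — with `W_n = (−1)^{n/2+1}·ω_n^∓` EXACTLY as in `hcongr`. The v31 skeleton derives S4′'s `CharRoadReciprocity`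
  from the levelwise stub S4″ by this theorem.
THEOREMS ONLY (`--supports stmt-BirchSwinnertonDyer-23599` helper); closes nothing; S4′/S4″, crux L and BSD remain OPEN and are proved for NO curve by any of this.
[cite: Kobayashi2003, Thm. 6.3] [cite: Pollack2003, §6.5 Prop. 6.18] [cite: PollackRubin2004, §6–§7] [folklore]
-/

set_option autoImplicit false
-- the Theorems namespace of this sub repeats the summit name by design (D-0017 nested layout)
set_option linter.dupNamespace false

noncomputable section

open Polynomial
open Literature.NumberTheory.EllipticCurves
open Summit.BirchSwinnertonDyer.BirchSwinnertonDyer.Theorems.ThetaTransport.MazurTateValuesRelay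

namespace Summit.BirchSwinnertonDyer.BirchSwinnertonDyer.Theorems.SmallImageRttReciprocity

variable {p : ℕ} [hp : Fact p.Prime]

/-- **Scaling a congruence by an integral constant**: `θ ≡ W·ι L (mod ω_n)` in `𝒪⟦T⟧ ⊗ ℚ` ⟹ `d·θ ≡ W·ι(d·L) (mod ω_n)` for `d ∈ 𝒪`. [cite: Sprung2017, Cor. 4.4 (shape)] [folklore] -/
theorem IsCongrModOmegaO.C_mul {S : Set (PadicAlgCl p)} {n : ℕ} {θ : (PadicAlgCl p)[X]} {W : PowerSeries (PadicAlgCl p)} {L : IwasawaAlgebraO S}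
    (h : IsCongrModOmegaO S n θ (W * iwasawaOToPowerSeries S L)) (d : padicCoeffIntegers S) :
    IsCongrModOmegaO S n (Polynomial.C (d : PadicAlgCl p) * θ) (W * iwasawaOToPowerSeries S (PowerSeries.C d * L)) := by
  obtain ⟨m, q, e⟩ := h
  refine ⟨m, PowerSeries.C d * q, ?_⟩
  simp only [map_mul, iwasawaOToPowerSeries_C, Polynomial.coe_mul, Polynomial.coe_C]
  linear_combination (PowerSeries.C (d : PadicAlgCl p)) * e

/-- ★★★ **Relay S4″ ⟹ S4′: levelwise Mazur–Tate congruences of the Coleman image give the reciprocity identity.** Let `x ∈ 𝒪_S⟦T⟧` (the Coleman image `Col(jv(s ζ̄_𝔞))`),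
`L ∈ 𝒪_T⟦T⟧` (the signed `p`-adic `L`-function of the prefix, `T = range ι`), `c, d ∈ 𝒪_{S∪T}` non-zero, and `θ_n`, `ε` as in `hcongr`. If for every `n` of parity `ε`
`d·θ_n ≡ (−1)^{n/2+1} ω_n^∓ · (c · ι_S x) (mod ω_n)` over `S ∪ T` and `θ_n ≡ (−1)^{n/2+1} ω_n^∓ · ι_T L (mod ω_n)` over `T`, then `ι_S x = C (d/c) · ι_T L` in `ℚ̄_p⟦T⟧`.
(Both `c·x` and `d·L`, moved to `𝒪_{S∪T}⟦T⟧`, satisfy the congruences for `d·θ_n`; `eq_of_forall_isCongrModOmegaO`.) [cite: Kobayashi2003, Thm. 6.3] [cite: Pollack2003, §6.5 Prop. 6.18] -/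
theorem iwasawaO_eq_C_mul_of_congruences (S T : Set (PadicAlgCl p)) [FiniteDimensional ℚ_[p] (padicCoeffField (S ∪ T))]
    (ε : ℤˣ) (θ : ℕ → (PadicAlgCl p)[X]) (x : IwasawaAlgebraO S) (L : IwasawaAlgebraO T) (c d : padicCoeffIntegers (S ∪ T)) (hc : c ≠ 0)
    (hx : ∀ n : ℕ, (Even n ↔ ε = 1) → IsCongrModOmegaO (S ∪ T) n (Polynomial.C (d : PadicAlgCl p) * θ n)
      (((((-1) ^ (n / 2 + 1) * (if ε = 1 then cyclotomicOmegaMinus p n else cyclotomicOmegaPlus p n)).map (Int.castRingHom (PadicAlgCl p)) :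
          (PadicAlgCl p)[X]) : PowerSeries (PadicAlgCl p)) * (PowerSeries.C (c : PadicAlgCl p) * iwasawaOToPowerSeries S x)))
    (hL : ∀ n : ℕ, (Even n ↔ ε = 1) → IsCongrModOmegaO T n (θ n)
      (((((-1) ^ (n / 2 + 1) * (if ε = 1 then cyclotomicOmegaMinus p n else cyclotomicOmegaPlus p n)).map (Int.castRingHom (PadicAlgCl p)) :
          (PadicAlgCl p)[X]) : PowerSeries (PadicAlgCl p)) * iwasawaOToPowerSeries T L)) :
    iwasawaOToPowerSeries S x = PowerSeries.C ((d : PadicAlgCl p) / (c : PadicAlgCl p)) * iwasawaOToPowerSeries T L := by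
  -- move `x` and `L` to `𝒪_{S ∪ T}⟦T⟧`
  set x' : IwasawaAlgebraO (S ∪ T) := (PowerSeries.map (Subring.inclusion (padicCoeffIntegers_mono Set.subset_union_left))) x with hx'
  set L' : IwasawaAlgebraO (S ∪ T) := (PowerSeries.map (Subring.inclusion (padicCoeffIntegers_mono Set.subset_union_right))) L with hL'
  have hιx : iwasawaOToPowerSeries (S ∪ T) x' = iwasawaOToPowerSeries S x := iwasawaOToPowerSeries_inclΛ Set.subset_union_left x
  have hιL : iwasawaOToPowerSeries (S ∪ T) L' = iwasawaOToPowerSeries T L := iwasawaOToPowerSeries_inclΛ Set.subset_union_right L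
  -- both `c·x'` and `d·L'` satisfy the congruences for `d·θ_n`
  have hA : ∀ n : ℕ, (Even n ↔ ε = 1) → IsCongrModOmegaO (S ∪ T) n (Polynomial.C (d : PadicAlgCl p) * θ n)
      (((((-1) ^ (n / 2 + 1) * (if ε = 1 then cyclotomicOmegaMinus p n else cyclotomicOmegaPlus p n)).map (Int.castRingHom (PadicAlgCl p)) :
          (PadicAlgCl p)[X]) : PowerSeries (PadicAlgCl p)) * iwasawaOToPowerSeries (S ∪ T) (PowerSeries.C c * x')) := by
    intro n hn
    have h := hx n hn
    rwa [map_mul, iwasawaOToPowerSeries_C, hιx]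
  have hB : ∀ n : ℕ, (Even n ↔ ε = 1) → IsCongrModOmegaO (S ∪ T) n (Polynomial.C (d : PadicAlgCl p) * θ n)
      (((((-1) ^ (n / 2 + 1) * (if ε = 1 then cyclotomicOmegaMinus p n else cyclotomicOmegaPlus p n)).map (Int.castRingHom (PadicAlgCl p)) :
          (PadicAlgCl p)[X]) : PowerSeries (PadicAlgCl p)) * iwasawaOToPowerSeries (S ∪ T) (PowerSeries.C d * L')) := by
    intro n hn
    have h : IsCongrModOmegaO (S ∪ T) n (θ n) _ := IsCongrModOmegaO.of_subset Set.subset_union_right (hL n hn)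
    rw [← hιL] at h
    exact IsCongrModOmegaO.C_mul h d
  have heq := eq_of_forall_isCongrModOmegaO (S ∪ T) ε (fun n ↦ Polynomial.C (d : PadicAlgCl p) * θ n) hA hB
  -- read it in `ℚ̄_p⟦T⟧` and divide by `c`
  have h1 := congrArg (iwasawaOToPowerSeries (S ∪ T)) heq
  rw [map_mul, map_mul, iwasawaOToPowerSeries_C, iwasawaOToPowerSeries_C, hιx, hιL] at h1
  have hc' : ((c : PadicAlgCl p)) ≠ 0 := by
    intro h0
    apply hc
    exact Subtype.ext (by simpa using h0)
  have hCc : (PowerSeries.C (c : PadicAlgCl p) : PowerSeries (PadicAlgCl p)) ≠ 0 := fun h0 ↦ hc' (PowerSeries.C_injective (h0.trans (map_zero _).symm))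
  apply mul_left_cancel₀ hCc
  rw [h1, ← mul_assoc, ← map_mul, mul_div_cancel₀ _ hc']

end Summit.BirchSwinnertonDyer.BirchSwinnertonDyer.Theorems.SmallImageRttReciprocity
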